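import Summits.BirchSwinnertonDyer.BirchSwinnertonDyer.Theorems.ManinLocalTwoThreeKummerMinimalDictionary
import Summits.BirchSwinnertonDyer.BirchSwinnertonDyer.Theorems.ManinLocalTwoThreeKummerSquareRootSigmaDictionary
import HarnessLib

/-!
# (DICT₂) — the ℓ = 2 formal ↔ analytic dictionary of the AN2₂ witness line: `Σ gₙqⁿ = κ·(t_W∘φ)·V_p(c·ℰ_f)` near `i∞` for the minimal-model transport `g` of a
# normalised square root `h` of the Kummer series `Ξ_T` (C2 skeleton v25, stub `stub_sqRootWitnessLawTwo`; LEAD-MEMO v36 §3)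
(route `ManinLocalTwoThree`, deciding crux C2 `ManinOddAtFour` stmt-BirchSwinnertonDyer-22967; cell bsd-f2-manin, C2/C3 LEAD p1 gen 18;
`--supports stmt-BirchSwinnertonDyer-22967`; the ℓ = 2 port of lead g16's (DICT) `MinimalDictionary.kummerMinimalDictionary_holds` (p733079) with p2 g17's
σ-square-root dictionary `KummerSquareRootDictionary.exists_hasSum_const_mul_shortT_mul_sigmaSqRoot` as engine)

* §1 `exists_hasSum_const_mul_shortT_mul_sigmaSqRoot_of_lift` — p2's dictionary for a PRESCRIBED half-period `p` (`p ∉ Λ`, `2p = m₁ω₁ + m₂ω₂`, `x_s(T) = c²℘(p)`):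
  `Σ hₙ𝕢₁(τ)ⁿ = κ·t_s(τ)·V_{p,m₁η₁+m₂η₂}(c·ℰ_f(τ))` for `Im τ > B`, `κ ≠ 0`;
* §2 **`kummerMinimalDictionaryTwo`** — for `g` with `c·(z·g) = z_W·h` (the (INT₂) output shape): for `Im τ > B`, `c·ℰ_f(τ) ∉ Λ`, `y_W∘φ ≠ 0` and
  `Σ gₙ𝕢₁(τ)ⁿ = κ·(minimalParam D τ)·(sigmaSqRoot D.L p e (c·ℰ_f τ))` — the block `(t_W∘φ)·V_p(cℰ)` of the would-be ℓ = 2 witness `F = C₀·B_d·block`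
  (the (HOLB₂)/(INVB₂)/(QEXNB₂) steps are the remaining ports).
HONEST FRAMING: analytic bookkeeping (germs at the cusp); nothing about C2, Manin's conjecture or BSD is proved.  No definitions, no sorry.
[folklore] [cite: WhittakerWatson1927, §20.421, §20.53 (σ-function identities behind the σ-square root)]
-/

set_option autoImplicit false
-- lint-debt: the directory name repeats the summit name (sibling precedent `ManinLocalTwoThreeKummerMinimalDictionary.lean`)
set_option linter.dupNamespace false

noncomputable section

open scoped Topology PeriodPair MatrixGroups
open Complex Filter PowerSeries CongruenceSubgroup
open UpperHalfPlane hiding I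
open WeierstrassCurve Literature.NumberTheory.EllipticCurves Literature.NumberTheory.EllipticCurves.ModularForms
open Summit.BirchSwinnertonDyer.Rank1Residual.ManinAdditive.CuspidalKummer
open Summit.BirchSwinnertonDyer.Rank1Residual.ManinAdditive.CuspidalKummerThree
open Summit.BirchSwinnertonDyer.Rank1Residual.ManinAdditive.KummerCubeMonodromy
open Summit.BirchSwinnertonDyer.Rank1Residual.ManinAdditive.UDCKummerWitnessLine
open Summit.BirchSwinnertonDyer.BirchSwinnertonDyer.Theorems.ManinLocalTwoThree.KummerCubeAnalytic
open Summit.BirchSwinnertonDyer.BirchSwinnertonDyer.Theorems.ManinLocalTwoThree.KummerCubeSigmaLeaves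
open Summit.BirchSwinnertonDyer.BirchSwinnertonDyer.Theorems.ManinLocalTwoThree.KummerCubeRootDictionary
open Summit.BirchSwinnertonDyer.BirchSwinnertonDyer.Theorems.ManinLocalTwoThree.SigmaSquareRoot
open Summit.BirchSwinnertonDyer.BirchSwinnertonDyer.Theorems.ManinLocalTwoThree.KummerSquareRootDictionary
open Summit.BirchSwinnertonDyer.BirchSwinnertonDyer.Theorems.ManinLocalTwoThree.MinimalDictionary

namespace Summit.BirchSwinnertonDyer.BirchSwinnertonDyer.Theorems.ManinLocalTwoThree.MinimalDictionaryTwo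

/-! ## §1 p2's σ-square-root dictionary for a prescribed half-period -/

/-- **(AN2-b)₂ for a PRESCRIBED half-period**: p2 g17's `exists_hasSum_const_mul_shortT_mul_sigmaSqRoot` with the S6₂-lift replaced by a given `p`
(`p ∉ Λ`, `2p = m₁ω₁ + m₂ω₂`, `x_s(T) = c²℘(p)`); proof = p2's, verbatim after the lift. [folklore] -/
theorem exists_hasSum_const_mul_shortT_mul_sigmaSqRoot_of_lift {W : WeierstrassCurve ℚ} {N : ℕ} [NeZero N] [W.IsElliptic] [W.IsGloballyMinimal]
    (D : ModularParametrizationData W N) (a : ℕ → ℤ) (ha : ∀ n, (a n : ℂ) = cuspCoeff D.f n) (hc0 : D.c ≠ 0)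
    {x₀ : ℚ} {p : ℂ} (hpΛ : p ∉ D.L.lattice) {m₁ m₂ : ℤ} (hm : m₁ * D.L.ω₁ + m₂ * D.L.ω₂ = 2 * p)
    (hX : ((shortRoot W D.c x₀ : ℚ) : ℂ) = (D.c : ℂ) ^ 2 * ℘[D.L] p)
    (z : ℚ⟦X⟧) (hz : IsParamGerm W D.c a z)
    (h : ℚ⟦X⟧) (hh2 : h ^ 2 = kummerSeries W D.c x₀ z) (hh0 : constantCoeff h = 1) :
    ∃ (κ : ℂ) (B : ℝ), κ ≠ 0 ∧
      ∀ τ : UpperHalfPlane, B < τ.im →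
        HasSum (fun n : ℕ => ((coeff n h : ℚ) : ℂ) * Function.Periodic.qParam 1 (τ : ℂ) ^ n)
          (κ * (shortT D τ * sigmaSqRoot D.L p (m₁ * D.L.η₁ + m₂ * D.L.η₂) ((D.c : ℂ) * eichlerIntegral D.f τ))) := by
  have hc : (D.c : ℂ) ≠ 0 := Int.cast_ne_zero.mpr hc0
  set e : ℂ := m₁ * D.L.η₁ + m₂ * D.L.η₂ with he
  -- S3₂
  obtain ⟨C, hC0, hS3⟩ := exists_weierstrassP_sub_eq_mul_sigmaSqRoot_sq D.L hpΛ hm.symm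
  -- prelims: `t_s·V = Φ(w)`
  obtain ⟨Φ, P₃, hΦan, hΦ0, hP₃d, hP₃0, hΦeq⟩ := exists_analytic_shortT_mul_sigmaSqRoot D hc0 hpΛ e
  -- §2: the holomorphic square root `R`
  obtain ⟨R, B₁, hRan, hR0, hR⟩ := exists_hasSum_sqRoot_kummerSeries D a ha hc0 x₀ z hz h hh2 hh0
  -- `q → 0`
  have hf1 : cuspCoeff D.f 1 = 1 := by
    rw [D.isNewformOf.2 1, W.isMultiplicative_LFunction.map_one]; simp
  have hev := eventually_smul_qGerm_notMem D.f hf1 D.L hc hP₃d.continuous.continuousAt (by rw [hP₃0]; norm_num)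
  obtain ⟨B₂, hB₂⟩ := exists_im_bound_of_eventually hev
  -- the square identity high in the strip: `R(q)² = K·Φ(w)²`, `K = c²C`
  set K : ℂ := (D.c : ℂ) ^ 2 * C with hK
  set Ψ : ℂ → ℂ := fun q => Φ ((D.c : ℂ) * qGerm D.f q) with hΨ
  have hΨan : AnalyticAt ℂ Ψ 0 := by
    have hinner : AnalyticAt ℂ (fun q : ℂ => (D.c : ℂ) * qGerm D.f q) 0 :=
      analyticAt_const.mul (analyticAt_qGerm D.f)
    have h0 : (fun q : ℂ => (D.c : ℂ) * qGerm D.f q) 0 = 0 := by simp [qGerm_zero]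
    have hcomp : AnalyticAt ℂ (Φ ∘ fun q : ℂ => (D.c : ℂ) * qGerm D.f q) 0 := hΦan.comp_of_eq hinner h0
    rw [hΨ]
    exact hcomp
  have hΨ0 : Ψ 0 = Φ 0 := by simp [hΨ, qGerm_zero]
  have hΨτ : ∀ τ : UpperHalfPlane, Ψ (Function.Periodic.qParam 1 (τ : ℂ)) = Φ ((D.c : ℂ) * eichlerIntegral D.f τ) := by
    intro τ; simp [hΨ, qGerm_apply]
  have hsqid : ∀ τ : UpperHalfPlane, max B₁ B₂ < τ.im →
      R (Function.Periodic.qParam 1 (τ : ℂ)) ^ 2 = K * Ψ (Function.Periodic.qParam 1 (τ : ℂ)) ^ 2 := by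
    intro τ hτ
    have h1 : B₁ < τ.im := (le_max_left _ _).trans_lt hτ
    have h2 : B₂ < τ.im := (le_max_right _ _).trans_lt hτ
    obtain ⟨hwΛ, hP₃w⟩ := hB₂ τ h2
    rw [qGerm_apply] at hwΛ hP₃w
    rw [(hR τ h1).2.1, hX, shortX, ← mul_sub, hS3 _ hwΛ, hΨτ, ← hΦeq τ hwΛ hP₃w, hK]
    ring
  have hev2 : ∀ᶠ q in 𝓝[≠] (0 : ℂ), R q ^ 2 = K * Ψ q ^ 2 := eventually_nhdsWithin_of_forall_im_gt hsqid
  have h0 : R 0 ^ 2 = K * Ψ 0 ^ 2 :=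
    eq_at_zero_of_eventuallyEq (F := fun q => R q ^ 2) (G := fun q => K * Ψ q ^ 2)
      (hRan.continuousAt.pow 2) (continuousAt_const.mul (hΨan.continuousAt.pow 2)) hev2
  have hfull : ∀ᶠ q in 𝓝 (0 : ℂ), R q ^ 2 = K * Ψ q ^ 2 := by
    have h' := eventually_nhdsWithin_iff.mp hev2
    filter_upwards [h'] with q hq
    by_cases hq0 : q = 0
    · subst hq0; exact h0
    · exact hq hq0
  have hΨ0ne : Ψ 0 ≠ 0 := by rw [hΨ0]; exact hΦ0
  set κ : ℂ := R 0 / Ψ 0 with hκdef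
  have hκ0 : κ ≠ 0 := div_ne_zero (by rw [hR0]; norm_num) hΨ0ne
  have hκ2 : κ ^ 2 = K := by
    rw [hκdef, div_pow, div_eq_iff (pow_ne_zero 2 hΨ0ne)]
    exact h0
  have hGan : AnalyticAt ℂ (fun q => κ * Ψ q) 0 := analyticAt_const.mul hΨan
  have hT : taylorAt0 (fun q => κ * Ψ q) = taylorAt0 R := by
    have hpow : taylorAt0 (fun q => κ * Ψ q) ^ 2 = taylorAt0 R ^ 2 := by
      rw [← taylorAt0_pow hGan 2, ← taylorAt0_pow hRan 2]
      apply taylorAt0_congr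
      filter_upwards [hfull] with q hq
      rw [mul_pow, hκ2, hq]
    have hcc : constantCoeff (taylorAt0 (fun q => κ * Ψ q)) = constantCoeff (taylorAt0 R) := by
      rw [constantCoeff_taylorAt0, constantCoeff_taylorAt0, hκdef, div_mul_cancel₀ _ hΨ0ne]
    refine eq_of_pow_eq_of_constantCoeff_eq two_ne_zero hpow hcc ?_
    rw [hcc, constantCoeff_taylorAt0, hR0]; norm_num
  have heq := eventuallyEq_of_taylorAt0_eq hGan hRan hT
  obtain ⟨B₃, hB₃⟩ := exists_im_bound_of_eventually (heq.filter_mono nhdsWithin_le_nhds)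
  refine ⟨κ, max (max B₁ B₂) B₃, hκ0, fun τ hτ => ?_⟩
  have h12 : max B₁ B₂ < τ.im := (le_max_left _ _).trans_lt hτ
  have h1 : B₁ < τ.im := (le_max_left _ _).trans_lt h12
  have h2 : B₂ < τ.im := (le_max_right _ _).trans_lt h12
  have h3 : B₃ < τ.im := (le_max_right _ _).trans_lt hτ
  obtain ⟨hwΛ, hP₃w⟩ := hB₂ τ h2
  rw [qGerm_apply] at hwΛ hP₃w
  have hsum := (hR τ h1).1
  rw [← hB₃ τ h3, hΨτ τ, ← hΦeq τ hwΛ hP₃w] at hsum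
  exact hsum

/-! ## §2 (DICT₂) -/

/-- **(DICT₂) the ℓ = 2 formal ↔ analytic dictionary for the MINIMAL square-root block**: for `g` with `c·(z·g) = z_W·h` (`h² = Ξ_T`, `h(0) = 1`), high in
the cusp one is off `B ∪ φ⁻¹(O)` and `Σ gₙqⁿ = κ·(t_W∘φ)·V_{p,e}(c·ℰ)` with `κ ≠ 0` (`e = m₁η₁ + m₂η₂`) — the ℓ = 3 proof of `MinimalDictionary.kummerMinimalDictionary_holds`
(lead g16) VERBATIM with the σ-cube root replaced by the σ-square root. [folklore] -/
theorem kummerMinimalDictionaryTwo {W : WeierstrassCurve ℚ} [W.IsElliptic] [W.IsGloballyMinimal] {N : ℕ} [NeZero N]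
    (D : ModularParametrizationData W N) (a : ℕ → ℤ) (ha : ∀ n, (a n : ℂ) = cuspCoeff D.f n)
    {x₀ : ℚ} {p : ℂ} (hu : p ∉ D.L.lattice) {m₁ m₂ : ℤ} (hm : m₁ * D.L.ω₁ + m₂ * D.L.ω₂ = 2 * p)
    (hX : ((shortRoot W D.c x₀ : ℚ) : ℂ) = (D.c : ℂ) ^ 2 * ℘[D.L] p)
    (z : ℚ⟦X⟧) (hz : IsParamGerm W D.c a z) (h : ℚ⟦X⟧) (hh3 : h ^ 2 = kummerSeries W D.c x₀ z) (hh0 : constantCoeff h = 1)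
    (g : ℚ⟦X⟧) (hg : (D.c : ℚ) • (z * g) = W.formalExp.subst ((D.c : ℚ) • lSeriesLog a) * h) :
    ∃ κ : ℂ, κ ≠ 0 ∧ ∃ B : ℝ, ∀ τ : ℍ, B < τ.im →
      (D.c : ℂ) * eichlerIntegral D.f τ ∉ D.L.lattice ∧ minimalY D τ ≠ 0 ∧
      HasSum (fun n : ℕ ↦ ((coeff n g : ℚ) : ℂ) * Function.Periodic.qParam 1 (τ : ℂ) ^ n)
        (κ * (minimalParam D τ * sigmaSqRoot D.L p (m₁ * D.L.η₁ + m₂ * D.L.η₂) ((D.c : ℂ) * eichlerIntegral D.f τ))) := by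
  have hc0 : D.c ≠ 0 := D.maninConstant_ne_zero_holds
  have hc : (D.c : ℂ) ≠ 0 := Int.cast_ne_zero.mpr hc0
  set zWq : ℚ⟦X⟧ := W.formalExp.subst ((D.c : ℚ) • lSeriesLog a) with hzWq
  set e : ℂ := m₁ * D.L.η₁ + m₂ * D.L.η₂ with he
  -- §1: `Σ hₙqⁿ = κ₀·t_s·V`
  obtain ⟨κ₀, B₁, hκ₀, hH⟩ :=
    exists_hasSum_const_mul_shortT_mul_sigmaSqRoot_of_lift D a ha hc0 hu hm hX z hz h hh3 hh0
  -- the analytic germ `H` of `Σ hₙqⁿ`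
  set hC : PowerSeries ℂ := h.map (algebraMap ℚ ℂ) with hhC
  have hcoefh : ∀ n, coeff n hC = ((coeff n h : ℚ) : ℂ) := fun n => by rw [hhC, coeff_map, eq_ratCast]
  have hH' : ∀ τ : ℍ, B₁ < τ.im → HasSum (fun n : ℕ => coeff n hC * Function.Periodic.qParam 1 (τ : ℂ) ^ n)
      (κ₀ * (shortT D τ * sigmaSqRoot D.L p e ((D.c : ℂ) * eichlerIntegral D.f τ))) := by
    intro τ hτ; simpa only [hcoefh] using hH τ hτ
  obtain ⟨H, hHan, hTH, B₂, hHval⟩ := exists_analyticAt_of_hasSum_qParam hH'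
  -- §2: the two parameter germs and their `dslope` factorisations
  obtain ⟨Z, hZan, hZ0, hTZ, B₃, hZval⟩ := exists_qGerm_shortT W D a ha hc0 z hz
  obtain ⟨ZW, hZWan, hZW0, hTZW, hZWval⟩ := exists_qGerm_minimalParam W D a ha hc0
  obtain ⟨Z₁, hZ₁an, hZfac, hTZ₁⟩ := exists_dslope_factor hZan hZ0
  obtain ⟨ZW₁, hZW₁an, hZWfac, hTZW₁⟩ := exists_dslope_factor hZWan hZW0
  -- `Z₁(0) = z₁ = 1`
  have hz1 : coeff 1 z = 1 := MinimalCubeRoot.coeff_one_shortGerm W D a ha hz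
  have hZ₁0 : Z₁ 0 = 1 := by
    have h1 := congrArg (coeff 1) hTZ₁
    rw [hTZ, coeff_map, hz1, map_one, show (1 : ℕ) = 0 + 1 from rfl, coeff_succ_X_mul,
      coeff_zero_eq_constantCoeff_apply, constantCoeff_taylorAt0] at h1
    exact h1.symm
  -- the germ `𝒢 = ZW₁·H/(c·Z₁)`
  set 𝒢 : ℂ → ℂ := fun q => ZW₁ q * H q / ((D.c : ℂ) * Z₁ q) with h𝒢
  have hden0 : (D.c : ℂ) * Z₁ 0 ≠ 0 := by rw [hZ₁0, mul_one]; exact hc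
  have h𝒢an : AnalyticAt ℂ 𝒢 0 := (hZW₁an.mul hHan).div (analyticAt_const.mul hZ₁an) hden0
  -- `𝓣[𝒢] = g`: from `𝒢·(c·Z₁) = ZW₁·H` near `0`, times `X`, and the formal relation `c·z·g = z_W·h`
  have hZ₁ne : ∀ᶠ q in 𝓝 (0 : ℂ), (D.c : ℂ) * Z₁ q ≠ 0 :=
    (analyticAt_const.mul hZ₁an).continuousAt.eventually_ne hden0
  have hprod : taylorAt0 𝒢 * (C (D.c : ℂ) * taylorAt0 Z₁) = taylorAt0 ZW₁ * taylorAt0 H := by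
    have h1 : taylorAt0 (fun q => 𝒢 q * ((D.c : ℂ) * Z₁ q)) = taylorAt0 (fun q => ZW₁ q * H q) := by
      apply taylorAt0_congr
      filter_upwards [hZ₁ne] with q hq
      rw [h𝒢]
      simp only
      rw [div_mul_cancel₀ _ hq]
    have h2 : taylorAt0 (fun q => 𝒢 q * ((D.c : ℂ) * Z₁ q)) = taylorAt0 𝒢 * (C (D.c : ℂ) * taylorAt0 Z₁) := by
      have hcz : taylorAt0 (fun q => (D.c : ℂ) * Z₁ q) = C (D.c : ℂ) * taylorAt0 Z₁ :=
        Literature.NumberTheory.Transcendental.AndreCriterion.taylor_const_mul (D.c : ℂ) Z₁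
      rw [← hcz]
      exact taylorAt0_mul h𝒢an (analyticAt_const.mul hZ₁an)
    have h3 : taylorAt0 (fun q => ZW₁ q * H q) = taylorAt0 ZW₁ * taylorAt0 H := taylorAt0_mul hZW₁an hHan
    rw [← h2, h1, h3]
  have hT𝒢 : taylorAt0 𝒢 = g.map (algebraMap ℚ ℂ) := by
    -- the formal relation, base-changed: `C c · z · g = z_W · h`
    have hrel : C (D.c : ℂ) * z.map (algebraMap ℚ ℂ) * g.map (algebraMap ℚ ℂ) =
        PowerSeries.map (algebraMap ℚ ℂ) zWq * hC := by
      have h := congrArg (PowerSeries.map (algebraMap ℚ ℂ)) hg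
      rw [smul_eq_C_mul, map_mul, map_mul, map_mul, PowerSeries.map_C, eq_ratCast, Rat.cast_intCast] at h
      rw [hhC, ← h, mul_assoc]
    -- `C c · z · 𝓣[𝒢] = z_W · h` from `hprod` times `X`
    have hrel' : C (D.c : ℂ) * z.map (algebraMap ℚ ℂ) * taylorAt0 𝒢 =
        PowerSeries.map (algebraMap ℚ ℂ) zWq * hC := by
      rw [← hTZ, ← hTZW, ← hTH, hTZ₁, hTZW₁]
      linear_combination X * hprod
    have hzne : C (D.c : ℂ) * z.map (algebraMap ℚ ℂ) ≠ 0 := by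
      refine mul_ne_zero ?_ ?_
      · intro h0
        have := congrArg constantCoeff h0
        rw [constantCoeff_C, map_zero] at this
        exact hc this
      · intro h0
        have := congrArg (coeff 1) h0
        rw [coeff_map, hz1, map_one, map_zero] at this
        exact one_ne_zero this
    have := hrel'.trans hrel.symm
    rw [mul_comm (C (D.c : ℂ) * z.map (algebraMap ℚ ℂ)) (taylorAt0 𝒢),
      mul_comm (C (D.c : ℂ) * z.map (algebraMap ℚ ℂ))] at this
    exact mul_right_cancel₀ hzne this
  -- `Σ gₙqⁿ → 𝒢(q)` on a ball
  obtain ⟨r, hr, hsum⟩ := exists_hasSum_taylorAt0 h𝒢an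
  -- side conditions high in the strip: `w ∉ Λ`, `Q(w) ≠ 0` (so `y_W∘φ ≠ 0`), `Z₁(q) ≠ 0`, `‖q‖ < r`
  obtain ⟨Q, A, hQd, -, hQ0, -, hYQ, -⟩ := WitnessInvariance.exists_minimal_package D hc0 p e
  have hf1 : cuspCoeff D.f 1 = 1 := by
    rw [D.isNewformOf.2 1, W.isMultiplicative_LFunction.map_one]; simp
  have hσ : Differentiable ℂ D.L.weierstrassSigma := D.L.differentiable_weierstrassSigma_holds
  obtain ⟨B₄, hB₄⟩ := exists_im_bound_of_eventually
    (eventually_smul_qGerm_notMem D.f hf1 D.L hc hQd.continuous.continuousAt (by rw [hQ0]; norm_num))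
  have hev5 : ∀ᶠ q in 𝓝[≠] (0 : ℂ), Z₁ q ≠ 0 ∧ ‖q‖ < r := by
    have h1 : ∀ᶠ q in 𝓝 (0 : ℂ), Z₁ q ≠ 0 := hZ₁an.continuousAt.eventually_ne (by rw [hZ₁0]; exact one_ne_zero)
    have h2 : ∀ᶠ q in 𝓝 (0 : ℂ), ‖q‖ < r := by
      have : Metric.ball (0 : ℂ) r ∈ 𝓝 (0 : ℂ) := Metric.ball_mem_nhds 0 hr
      filter_upwards [this] with q hq
      rwa [Metric.mem_ball, dist_zero_right] at hq
    exact (h1.and h2).filter_mono nhdsWithin_le_nhds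
  obtain ⟨B₅, hB₅⟩ := exists_im_bound_of_eventually hev5
  -- assemble
  refine ⟨κ₀ / (D.c : ℂ), div_ne_zero hκ₀ hc, max (max B₂ B₃) (max B₄ B₅), fun τ hτ => ?_⟩
  have h23 : max B₂ B₃ < τ.im := (le_max_left _ _).trans_lt hτ
  have h45 : max B₄ B₅ < τ.im := (le_max_right _ _).trans_lt hτ
  have h2 : B₂ < τ.im := (le_max_left _ _).trans_lt h23
  have h3 : B₃ < τ.im := (le_max_right _ _).trans_lt h23
  have h4 : B₄ < τ.im := (le_max_left _ _).trans_lt h45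
  have h5 : B₅ < τ.im := (le_max_right _ _).trans_lt h45
  set q : ℂ := Function.Periodic.qParam 1 (τ : ℂ) with hq
  set w : ℂ := (D.c : ℂ) * eichlerIntegral D.f τ with hw
  obtain ⟨hwΛ, hQw⟩ := hB₄ τ h4
  rw [qGerm_apply] at hwΛ hQw
  obtain ⟨hZ₁q, hqr⟩ := hB₅ τ h5
  have hσw : D.L.weierstrassSigma w ≠ 0 := fun h0 => hwΛ ((D.L.weierstrassSigma_eq_zero_iff_holds w).mp h0)
  have hYne : minimalY D τ ≠ 0 := by
    rw [hYQ τ hwΛ]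
    exact div_ne_zero (mul_ne_zero (div_ne_zero (pow_ne_zero 3 hc) two_ne_zero) hQw) (pow_ne_zero 3 hσw)
  refine ⟨hwΛ, hYne, ?_⟩
  -- the value `𝒢(q) = (κ₀/c)·t_W·W`
  have hq0 : q ≠ 0 := by
    rw [hq, ← norm_pos_iff, Function.Periodic.norm_qParam]; exact Real.exp_pos _
  have htne : shortT D τ ≠ 0 := by
    rw [← hZval τ h3, hZfac]; exact mul_ne_zero hq0 hZ₁q
  have hval : 𝒢 q = κ₀ / (D.c : ℂ) * (minimalParam D τ * sigmaSqRoot D.L p e w) := by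
    have hZW₁q : ZW₁ q = minimalParam D τ / q := by
      rw [eq_div_iff hq0, mul_comm, ← hZWfac]; exact hZWval τ hwΛ
    have hZ₁q' : Z₁ q = shortT D τ / q := by
      rw [eq_div_iff hq0, mul_comm, ← hZfac]; exact hZval τ h3
    rw [h𝒢]
    simp only
    rw [hZW₁q, hZ₁q', hHval τ h2, ← hw]
    field_simp
  have hs := hsum q hqr
  rw [hT𝒢, hval] at hs
  have hfun : (fun n : ℕ => ((coeff n g : ℚ) : ℂ) * q ^ n) =
      fun n : ℕ => coeff n (g.map (algebraMap ℚ ℂ)) * q ^ n := by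
    funext n; rw [coeff_map, eq_ratCast]
  rw [hfun]
  exact hs

end Summit.BirchSwinnertonDyer.BirchSwinnertonDyer.Theorems.ManinLocalTwoThree.MinimalDictionaryTwo

end
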